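/-
Copyright (c) 2026 the pub-hodgecm-mathlib formalisation cell (harness21).  Prover seat hodgecm-mathlib-K2-defs1 (g6), Track B, h413 = `stmt-HodgeConjecture-24833`, route `HCCMUnconditional`,
campaign «5Res (b) BL-2(χ,τ)», SHEET row 11 (dealer K2E1-plan (g6) (109) 2026-09-04T10:58:56Z; REPORT-FIRST 11:00Z).
-/
import Summits.HodgeConjecture.HodgeConjecture.Theorems.K2E1SphericalEisensteinSolvesXSystemU2   -- ★ p859074 spherical part 1: ℓ8 compat `iota_toHX_eq_toHN`, `memLp_zFun_of_iotaBound`, §3 Hilbert, §4 majorants; brings P2b′, «E ⊥ 𝒞_k», (b1)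
import Summits.HodgeConjecture.HodgeConjecture.Theorems.K2E1ChiSectionSpaceU2Defs                -- ★ p859551 (this seat) row 9: `chiSectionSpace`
import Summits.HodgeConjecture.HodgeConjecture.Theorems.K2E1ChiIntertwinedSectionU2               -- ★ p859530 (this seat) row 3: `isChiSection_intertwinedCoeff_two`, `flatSectionU_intertwinedCoeff_two`
import Summits.HodgeConjecture.HodgeConjecture.Theorems.K2E1TruncatedCuspConstantTermAEU2          -- ★ p859335 (this seat): `sFinite_of_isHaarMeasure_adelicUnipotent`; brings FILE M `measurable_invariantSigma_zFun_of_measurable`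
import Summits.HodgeConjecture.HodgeConjecture.Theorems.K2E1BorelEisensteinRegularU                -- ★ `continuous_eisensteinSeriesU_flatSectionU_cm_two`
import Summits.HodgeConjecture.HodgeConjecture.Theorems.K2E1BorelCosetsDictionary                  -- ★ `forall_arithmeticBorel_iff`
import HarnessLib

/-!
# 5Res (b) row 11 — `K2E1ChiEisensteinSolvesXSystemU2`: «`E(f_z)` SOLVES THE (χ,τ) 𝔛-SYSTEM» on `U(1,1)_{L∕L⁺}` — (S2) the constant-term equation with a VECTOR unknown in the `χʷ`-section space,
# (S3) `Q [Ẽ(f_z)] = 0`, for a bounded continuous `χ`-section `φ ∈ V(χ, K′, ω)` and `1 < Re z`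

Cell `pub/hodgecm-mathlib`, crux H413 = `stmt-HodgeConjecture-24833`.  THEOREMS ONLY (no `def`, no `instance`, no notation, no named-fact hypothesis, no `sorry`); lane `--supports
stmt-HodgeConjecture-24833 --as helper` (count-neutral).  Closes no socket.  The (χ,τ) twin of ★ `K2E1SphericalEisensteinSolvesXSystemU2` (`φ = fun _ => φ₀`, scalar `b : ℂ`).

THE MATHEMATICS ([BernsteinLapid2019, §4 Claims 1–5, §7]; [MoeglinWaldspurger1995, I.2.6, II.1.7, IV.1.8]).  `f_z = φ·H^z` for `φ ∈ V(χ,K′,ω)` (★ row 9 `chiSectionSpace`: `φ(b g) = χ(b₀₀)φ(g)`,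
`φ(g k) = ω(k)φ(g)`), `W = ι(w₀)`, `φ̃(g) := (∫_{N(𝔸)} f_z(W v g) dν)·H(g)^{z−1}` the intertwined coefficient (★ row 3: a `χʷ`-section, `χʷ = reflectChar c χ`).
§1 (generic rank) TWO UPGRADES: (a) ★ P2b′ `cnstN_toHN_eq_toHN_borelConstantTerm'` with its `Continuous Φ_B` binder REPLACED by Borel-measurability of `Φ` — the `mN`-measurability of
`zFun Φ_B` comes from FILE M ★ `measurable_invariantSigma_zFun_of_measurable` (Borel descent) + ★ `measurable_borelConstantTerm` + ★ FILE A `borelConstantTerm_adelicUnipBorel_mul` — so that no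
continuity of `φ̃` (a dominated-convergence statement) is needed; (b) `φ ∈ V(χ,K′,ω)`, `K′ ≤ K` ⟹ `φ̃ ∈ V(χʷ,K′,ω)` (★ row 3 + `H(g k) = H(g)`).  §2 (S2)χ: given ROW 2's constant term as the LETTER
`hct : E_B(f_z) = f_z + (ν𝓕)⁻¹·∫_N f_z(W v ·) dν` (K2E1-p15 discharges it; ★ generic unfolding shape), `cnst_N(ι[Ẽ(f_z)]) = [f_z] + (ν𝓕)⁻¹ • [φ̃·H^{1−z}]` in `𝓗_k(Z_a)` — the scalar
`b•[H^{1−z}]` of the spherical (S2) becomes the VECTOR `[flatSectionU φ̃ (1−z)]`, `φ̃ ∈ V(χʷ,K′,ω)` (finite-dimensional, ★ row 9).  §3 (S3)χ: `Q [Ẽ(f_z)] = 0` for `Q` the projection onto the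
closed span of classes `[w₁^{2k}ψ̃]`, `ψ ∈ 𝒞_k` Borel — ★ «E ⊥ 𝒞_k» is generic in the section; its finiteness letter `hX` is discharged by `Σ_q‖f_z(q·)‖ₑ ≤ ‖φ‖_∞·Σ_q‖H^z(q·)‖ₑ` and the ★
spherical majorant at `φ₀ = 1`.  (S1) (the Hecke MATRIX clause, row 10) and the packaged head are the sequel `…Head.lean` (400-line rule, as in the spherical split).
* §1 `cnstN_toHN_eq_toHN_borelConstantTerm_of_measurable`, `flatSectionU_mul_of_mem_comap`, `intertwinedCoeff_mul_right_of_mem`, `intertwinedCoeff_mem_chiSectionSpace`.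
* §2 `eisensteinSeriesU_flatSectionU_quotientSubgroup_mul_of_isChiSection`, **`cnstN_iota_toHX_eisensteinSeriesU_eq_chi_cm_two`**.
* §3 `tsum_enorm_flatSectionU_le_mul_tsum`, `lintegral_tsum_enorm_flatSectionU_mul_enorm_lt_top_chi_cm_two`, `inner_toHX_eisensteinSeriesU_eq_zero_chi_cm_two`, **`starProjection_toHX_eisensteinSeriesU_eq_zero_chi_cm_two`**.
* The packaged head (conjoining row 10's Hecke-MATRIX clause (S1)) goes to the sequel `…Head.lean`, exactly as the spherical split ★ `K2E1SphericalEisensteinSolvesXSystemU2Head`.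
HONEST LABEL: HC_CM is proved only modulo the 7 printed citations (2 remaining named inputs: hLiu418 = `stmt-HodgeConjecture-24832`, h413 = `stmt-HodgeConjecture-24833`) until rung 0
closes; count-neutral helper, closes no socket.

## References
* [BernsteinLapid2019] J. Bernstein, E. Lapid, *On the meromorphic continuation of Eisenstein series*, arXiv:1911.02342, §4 (Claims 1–5, pp. 9–10), §7.
* [MoeglinWaldspurger1995] C. Mœglin, J.-L. Waldspurger, *Spectral decomposition and Eisenstein series* (1995), I.2.6, II.1.7, IV.1.8.
-/

set_option autoImplicit false
-- the mandated namespace repeats the single-problem summit's segment (`HodgeConjecture.HodgeConjecture`)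
set_option linter.dupNamespace false

noncomputable section

open MeasureTheory Measure NumberField IsDedekindDomain Set Filter MulAction
open scoped ENNReal NNReal ComplexConjugate
open Literature.MeasureTheory.Group Literature.NumberTheory Literature.NumberTheory.Automorphic Literature.NumberTheory.Automorphic.UnitaryGroup AdelicGroupData
open Literature.NumberTheory.GaloisRepresentations (HeckeCharacter)
open Summit.HodgeConjecture.HodgeConjecture.Cruxes.H413.K2E1BorelEisensteinU
open Summit.HodgeConjecture.HodgeConjecture.Cruxes.H413.K2E1BLBorelSpacesU2Defs
open Summit.HodgeConjecture.HodgeConjecture.Cruxes.H413.K2E1BLBorelOperatorsU2Defs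
open Summit.HodgeConjecture.HodgeConjecture.Cruxes.H413.K2E1CharacterEisensteinU2Defs
open Summit.HodgeConjecture.HodgeConjecture.Cruxes.H413.K2E1ChiSectionSpaceU2Defs
open Summit.HodgeConjecture.HodgeConjecture.Cruxes.H413.K2E1ChiIntertwinedSectionU2 (isChiSection_intertwinedCoeff_two)
open Summit.HodgeConjecture.HodgeConjecture.Cruxes.H413.K2E1MaassSelbergCMTwoConstantTerms (flatSectionU_intertwinedCoeff_two)
open Summit.HodgeConjecture.HodgeConjecture.Cruxes.H413.K2E1MaassSelbergBracketsThree (measurable_flatSectionU)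
open Summit.HodgeConjecture.HodgeConjecture.Cruxes.H413.K2E1BLConstantTermProjectionU2 (cnstN_toHN_eq_toHN_of_forall_setIntegral_eq borelConstantTerm_adelicUnipBorel_mul)
open Summit.HodgeConjecture.HodgeConjecture.Cruxes.H413.K2E1BLConstantTermProjectionMeasurableU2 (setIntegral_zFun_borelConstantTerm_eq')
open Summit.HodgeConjecture.HodgeConjecture.Cruxes.H413.K2E1BLInvariantSigmaDescentU (measurable_invariantSigma_zFun_of_measurable)
open Summit.HodgeConjecture.HodgeConjecture.Cruxes.H413.K2E1TruncatedCuspConstantTermAEU2 (sFinite_of_isHaarMeasure_adelicUnipotent)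
open Summit.HodgeConjecture.HodgeConjecture.Cruxes.H413.K2E1TruncatedEisensteinBoundedCMThree (measurable_borelConstantTerm)
open Summit.HodgeConjecture.HodgeConjecture.Cruxes.H413.K2E1SphericalEisensteinSolvesXSystemU2
open Summit.HodgeConjecture.HodgeConjecture.Cruxes.H413.K2E1BLEisensteinInWeightedSpaceU2Weights (exists_pos_forall_le_supHeight_cm)
open Summit.HodgeConjecture.HodgeConjecture.Cruxes.H413.K2E1BLEisensteinInWeightedSpaceU3 (integral_quotFun_eisensteinSeriesU_mul_conj_eq_zero_of_mem_cuspTestClass_cm_two)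
open Summit.HodgeConjecture.HodgeConjecture.Cruxes.H413.K2E1BLIotaBoundU2 (measurable_supHeight)
open Summit.HodgeConjecture.HodgeConjecture.Cruxes.H413.K2E1BorelCosetsDictionary (forall_arithmeticBorel_iff)
open Summit.HodgeConjecture.HodgeConjecture.Cruxes.H413.K2E1BorelEisensteinRegularU (continuous_eisensteinSeriesU_flatSectionU_cm_two)

namespace Summit.HodgeConjecture.HodgeConjecture.Cruxes.H413.K2E1ChiEisensteinSolvesXSystemU2

/-! ## §1 Generic rank: P2b′ with a Borel constant term; the intertwined coefficient lies in `V(χʷ, K′, ω)` -/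

section Generic

variable {F E : Type} [Field F] [NumberField F] [Field E] [NumberField E] [Algebra F E] {c : E ≃ₐ[F] E} {N : ℕ} [NeZero N]
variable [MeasurableSpace (quasiSplit F E c N).Adelic] [BorelSpace (quasiSplit F E c N).Adelic]
variable (ν : Measure ↥(adelicUnipotent F E c N)) (𝓕 : Set ↥(adelicUnipotent F E c N)) (k : ℕ) (c₁ : ℝ≥0) (μZ : Measure (borelQuotient F E c N))

/-- **P2b′ WITH A BOREL (NOT NECESSARILY CONTINUOUS) CONSTANT TERM**: `cnst_N (toHN φ) = toHN (φ_B)` for Borel, left-`B(F)`-invariant `φ` with `zFun φ, zFun φ_B ∈ L²(wtm)`, under the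
disintegration letter `hdis′` — ★ `cnstN_toHN_eq_toHN_of_forall_setIntegral_eq` with the `mN`-measurability of `zFun φ_B` taken from FILE M (★ `measurable_invariantSigma_zFun_of_measurable`:
`φ_B` is Borel ★ `measurable_borelConstantTerm` and left-`N(𝔸)B(F)`-invariant ★ `borelConstantTerm_adelicUnipBorel_mul`) instead of the continuity road of ★ P2b′. [cite: BernsteinLapid2019, §4 Claim 4 p. 10] [cite: MoeglinWaldspurger1995, I.2.6] -/
theorem cnstN_toHN_eq_toHN_borelConstantTerm_of_measurable [ν.IsHaarMeasure] [ν.IsMulRightInvariant]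
    (h𝓕 : IsFundamentalDomain ↥(rationalUnipotent F E c N) 𝓕 ν) [IsFiniteMeasure (weightedTruncMeasure F E c N k c₁ μZ)]
    (hdis' : ∀ Φ : (quasiSplit F E c N).Adelic → ℂ, Measurable Φ → (∀ b ∈ ratBorelSubgroup F E c N, ∀ g, Φ (b * g) = Φ g) →
      Integrable (zFun F E c N Φ) (weightedTruncMeasure F E c N k c₁ μZ) →
      Integrable (zFun F E c N (borelConstantTerm ν 𝓕 Φ)) (weightedTruncMeasure F E c N k c₁ μZ) →
        ∫ z, zFun F E c N (borelConstantTerm ν 𝓕 Φ) z ∂weightedTruncMeasure F E c N k c₁ μZ =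
          ∫ z, zFun F E c N Φ z ∂weightedTruncMeasure F E c N k c₁ μZ)
    {φ : (quasiSplit F E c N).Adelic → ℂ} (hφm : Measurable φ) (hφB : ∀ b ∈ ratBorelSubgroup F E c N, ∀ g, φ (b * g) = φ g)
    (hφ2 : MemLp (zFun F E c N φ) 2 (weightedTruncMeasure F E c N k c₁ μZ))
    (hψ2 : MemLp (zFun F E c N (borelConstantTerm ν 𝓕 φ)) 2 (weightedTruncMeasure F E c N k c₁ μZ)) :
    cnstN F E c N k c₁ μZ (toHN F E c N k c₁ μZ φ hφ2) = toHN F E c N k c₁ μZ (borelConstantTerm ν 𝓕 φ) hψ2 := by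
  haveI := sFinite_of_isHaarMeasure_adelicUnipotent ν
  exact cnstN_toHN_eq_toHN_of_forall_setIntegral_eq k c₁ μZ hφ2 hψ2
    (measurable_invariantSigma_zFun_of_measurable (measurable_borelConstantTerm ν 𝓕 hφm)
      (borelConstantTerm_adelicUnipBorel_mul ν h𝓕 hφB)).stronglyMeasurable.aestronglyMeasurable
    (fun _ hs _ => setIntegral_zFun_borelConstantTerm_eq' ν 𝓕 k c₁ μZ hdis' hφm hφB (hφ2.integrable one_le_two) (hψ2.integrable one_le_two) hs)

variable {χ : HeckeCharacter E} {K' : Subgroup (quasiSplit F E c N).Adelic} {ω : ↥K' → ℂ}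

omit [MeasurableSpace (quasiSplit F E c N).Adelic] [BorelSpace (quasiSplit F E c N).Adelic] in
/-- **`f_z(g k) = ω(k)·f_z(g)`** for `φ ∈ V(χ, K′, ω)` and `k ∈ K′ ≤ K` (`H(g k) = H(g)`, ★ `borelHeight_mul_of_mem_comap_standardMaximalCompactGL`). [cite: MoeglinWaldspurger1995, I.2.17] -/
theorem flatSectionU_mul_of_mem_comap
    (hK' : K' ≤ ((standardMaximalCompactGL N E).comap (adelicVal F E c N ((StdForm.antidiagonal N).over E)) : Subgroup (quasiSplit F E c N).Adelic))
    {φ : (quasiSplit F E c N).Adelic → ℂ} (hφ : φ ∈ chiSectionSpace χ K' ω) (z : ℂ) (g : (quasiSplit F E c N).Adelic) (k₀ : ↥K') :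
    flatSectionU φ z (g * (k₀ : (quasiSplit F E c N).Adelic)) = ω k₀ * flatSectionU φ z g := by
  rw [flatSectionU_apply, flatSectionU_apply, apply_mul_of_mem hφ g k₀, borelHeight_mul_of_mem_comap_standardMaximalCompactGL (hK' k₀.2) g, mul_assoc]

end Generic

section IntertwinedTwo

variable {F E : Type} [Field F] [NumberField F] [Field E] [NumberField E] [Algebra F E] {c : E ≃ₐ[F] E}
variable [MeasurableSpace (quasiSplit F E c 2).Adelic] [BorelSpace (quasiSplit F E c 2).Adelic]
variable {χ : HeckeCharacter E} {K' : Subgroup (quasiSplit F E c 2).Adelic} {ω : ↥K' → ℂ}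

omit [BorelSpace (quasiSplit F E c 2).Adelic] in
/-- **`φ̃(g k) = ω(k)·φ̃(g)`** for the intertwined coefficient of `φ ∈ V(χ, K′, ω)`, `K′ ≤ K` (`W v (g k) = (W v g) k`, the previous lemma under the integral, `H(g k) = H(g)`). [cite: MoeglinWaldspurger1995, II.1.6] -/
theorem intertwinedCoeff_mul_right_of_mem (ν : Measure ↥(adelicUnipotent F E c 2))
    (hK' : K' ≤ ((standardMaximalCompactGL 2 E).comap (adelicVal F E c 2 ((StdForm.antidiagonal 2).over E)) : Subgroup (quasiSplit F E c 2).Adelic))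
    {φ : (quasiSplit F E c 2).Adelic → ℂ} (hφ : φ ∈ chiSectionSpace χ K' ω) (z : ℂ) (g : (quasiSplit F E c 2).Adelic) (k₀ : ↥K') :
    (∫ v : ↥(adelicUnipotent F E c 2), flatSectionU φ z ((quasiSplit F E c 2).toAdelic (weylLongU (c : E →+* E) (rfl : (StdForm.antidiagonal 2).over E = (StdForm.antidiagonal 2).over E)) *
        ((v : (quasiSplit F E c 2).Adelic) * (g * (k₀ : (quasiSplit F E c 2).Adelic)))) ∂ν) * (((borelHeight (g * (k₀ : (quasiSplit F E c 2).Adelic)) : ℝ) : ℂ) ^ (z - 1)) =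
      ω k₀ * ((∫ v : ↥(adelicUnipotent F E c 2), flatSectionU φ z ((quasiSplit F E c 2).toAdelic (weylLongU (c : E →+* E) (rfl : (StdForm.antidiagonal 2).over E = (StdForm.antidiagonal 2).over E)) *
        ((v : (quasiSplit F E c 2).Adelic) * g)) ∂ν) * (((borelHeight g : ℝ) : ℂ) ^ (z - 1))) := by
  have h1 : ∀ v : ↥(adelicUnipotent F E c 2), flatSectionU φ z ((quasiSplit F E c 2).toAdelic (weylLongU (c : E →+* E) (rfl : (StdForm.antidiagonal 2).over E = (StdForm.antidiagonal 2).over E)) *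
        ((v : (quasiSplit F E c 2).Adelic) * (g * (k₀ : (quasiSplit F E c 2).Adelic)))) =
      ω k₀ * flatSectionU φ z ((quasiSplit F E c 2).toAdelic (weylLongU (c : E →+* E) (rfl : (StdForm.antidiagonal 2).over E = (StdForm.antidiagonal 2).over E)) * ((v : (quasiSplit F E c 2).Adelic) * g)) :=
    fun v => by rw [← mul_assoc, ← mul_assoc, flatSectionU_mul_of_mem_comap hK' hφ z, mul_assoc]
  simp_rw [h1]
  rw [integral_const_mul, borelHeight_mul_of_mem_comap_standardMaximalCompactGL (hK' k₀.2) g]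
  ring

/-- **THE INTERTWINED COEFFICIENT LIES IN `V(χʷ, K′, ω)`**: for a Borel `φ ∈ V(χ, K′, ω)` with `K′ ≤ K` (`c² = 1`, `c ≠ 1`) and any `z`, `φ̃ = (M(w₀) f_z)·H^{z−1} ∈ chiSectionSpace (reflectChar c χ) K′ ω`
— ★ row 3 `isChiSection_intertwinedCoeff_two` and the previous lemma.  This is where the spherical scalar `b•H^{1−z}` becomes a VECTOR of the finite-dimensional `χʷ`-space (★ row 9).
[cite: MoeglinWaldspurger1995, II.1.7] [cite: BernsteinLapid2019, §7] -/
theorem intertwinedCoeff_mem_chiSectionSpace (hc : c * c = 1) (hc1 : c ≠ 1) (ν : Measure ↥(adelicUnipotent F E c 2)) [ν.IsHaarMeasure]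
    (hK' : K' ≤ ((standardMaximalCompactGL 2 E).comap (adelicVal F E c 2 ((StdForm.antidiagonal 2).over E)) : Subgroup (quasiSplit F E c 2).Adelic))
    {φ : (quasiSplit F E c 2).Adelic → ℂ} (hφ : φ ∈ chiSectionSpace χ K' ω) (hφm : Measurable φ) (z : ℂ) :
    (fun g : (quasiSplit F E c 2).Adelic => (∫ v : ↥(adelicUnipotent F E c 2), flatSectionU φ z ((quasiSplit F E c 2).toAdelic (weylLongU (c : E →+* E) (rfl : (StdForm.antidiagonal 2).over E = (StdForm.antidiagonal 2).over E)) *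
        ((v : (quasiSplit F E c 2).Adelic) * g)) ∂ν) * (((borelHeight g : ℝ) : ℂ) ^ (z - 1))) ∈ chiSectionSpace (reflectChar c χ) K' ω :=
  ⟨isChiSection_intertwinedCoeff_two hc hc1 ν hφ.1 hφm z, fun g k₀ => intertwinedCoeff_mul_right_of_mem ν hK' hφ z g k₀⟩

end IntertwinedTwo

/-! ## §2 (S2)χ The constant-term equation `cnst_N (ι [Ẽ(f_z)]) = [f_z] + (ν𝓕)⁻¹ • [φ̃·H^{1−z}]` on `U(1,1)_{L∕L⁺}` -/

section ConstantTerm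

variable (L : Type) [Field L] [NumberField L] [IsCMField L]
variable [MeasurableSpace (quasiSplit (↥(maximalRealSubfield L)) L (IsCMField.complexConj L) 2).Adelic] [BorelSpace (quasiSplit (↥(maximalRealSubfield L)) L (IsCMField.complexConj L) 2).Adelic]

omit [MeasurableSpace (quasiSplit (↥(maximalRealSubfield L)) L (IsCMField.complexConj L) 2).Adelic] [BorelSpace (quasiSplit (↥(maximalRealSubfield L)) L (IsCMField.complexConj L) 2).Adelic] in
/-- `E(f_z)` of a `χ`-section is left-`G(F)`-invariant in the `quotientSubgroup` spelling (★ `eisensteinSeriesU_flatSectionU_rational_mul` with ★ `IsChiSection.toAdelic_mul`, ★ `quotientSubgroup_quasiSplit`).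
[cite: MoeglinWaldspurger1995, II.1.5] -/
theorem eisensteinSeriesU_flatSectionU_quotientSubgroup_mul_of_isChiSection {χ : HeckeCharacter L} {φ : (quasiSplit (↥(maximalRealSubfield L)) L (IsCMField.complexConj L) 2).Adelic → ℂ}
    (hφ : IsChiSection χ φ) (z : ℂ) :
    ∀ γ ∈ (quasiSplit (↥(maximalRealSubfield L)) L (IsCMField.complexConj L) 2).quotientSubgroup, ∀ g : (quasiSplit (↥(maximalRealSubfield L)) L (IsCMField.complexConj L) 2).Adelic,
      (eisensteinSeriesU (flatSectionU φ z)) (γ * g) = (eisensteinSeriesU (flatSectionU φ z)) g := by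
  intro γ hγ g
  rw [quotientSubgroup_quasiSplit] at hγ
  obtain ⟨γ', hγ'⟩ := MonoidHom.mem_range.1 hγ
  rw [← hγ']
  exact eisensteinSeriesU_flatSectionU_rational_mul hφ.toAdelic_mul z γ' g

/-- **(S2)χ THE CONSTANT-TERM EQUATION FOR `E(f_z)` IN `𝓗_k(Z_a)` WITH A VECTOR UNKNOWN.**  On `U(1,1)_{L∕L⁺}`, `φ ∈ V(χ, K′, ω)` Borel, bounded and continuous, `1 < Re z`, given ROW 2's
constant term as the letter `hct` (`E_B(f_z) = f_z + (ν𝓕)⁻¹·∫_N f_z(W v ·) dν`, ★ generic unfolding shape) and the structural letters `hb` (★ `IotaBound`), `hdis′` (disintegration):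
`cnst_N (ι [Ẽ(f_z)]) = toHN f_z + ((ν𝓕)⁻¹ : ℂ) • toHN (flatSectionU φ̃ (1 − z))`, `φ̃` the intertwined coefficient (a member of `V(χʷ, K′, ω)` by §1 when `K′ ≤ K`).  Letters `hα₁`, `hα₂` =
square-integrability of the `Z`-lifts of `f_z` and `φ̃·H^{1−z}`. [cite: BernsteinLapid2019, §4 (p. 10), §7] [cite: MoeglinWaldspurger1995, I.2.6, II.1.7] -/
theorem cnstN_iota_toHX_eisensteinSeriesU_eq_chi_cm_two
    (ν : Measure ↥(adelicUnipotent (↥(maximalRealSubfield L)) L (IsCMField.complexConj L) 2)) [ν.IsHaarMeasure] [ν.IsMulRightInvariant]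
    {𝓕 : Set ↥(adelicUnipotent (↥(maximalRealSubfield L)) L (IsCMField.complexConj L) 2)}
    (h𝓕N : IsFundamentalDomain ↥(rationalUnipotent (↥(maximalRealSubfield L)) L (IsCMField.complexConj L) 2) 𝓕 ν)
    {μ : Measure (quasiSplit (↥(maximalRealSubfield L)) L (IsCMField.complexConj L) 2).automorphicQuotient} {k : ℕ} {a : ℝ≥0} {μZ : Measure (borelQuotient (↥(maximalRealSubfield L)) L (IsCMField.complexConj L) 2)}
    [IsFiniteMeasure (weightedTruncMeasure (↥(maximalRealSubfield L)) L (IsCMField.complexConj L) 2 k a μZ)]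
    (hb : IotaBound (↥(maximalRealSubfield L)) L (IsCMField.complexConj L) 2 k a μ μZ)
    (hdis' : ∀ Φ : (quasiSplit (↥(maximalRealSubfield L)) L (IsCMField.complexConj L) 2).Adelic → ℂ, Measurable Φ → (∀ b ∈ ratBorelSubgroup (↥(maximalRealSubfield L)) L (IsCMField.complexConj L) 2, ∀ g, Φ (b * g) = Φ g) →
      Integrable (zFun (↥(maximalRealSubfield L)) L (IsCMField.complexConj L) 2 Φ) (weightedTruncMeasure (↥(maximalRealSubfield L)) L (IsCMField.complexConj L) 2 k a μZ) →
      Integrable (zFun (↥(maximalRealSubfield L)) L (IsCMField.complexConj L) 2 (borelConstantTerm ν 𝓕 Φ)) (weightedTruncMeasure (↥(maximalRealSubfield L)) L (IsCMField.complexConj L) 2 k a μZ) →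
        ∫ x, zFun (↥(maximalRealSubfield L)) L (IsCMField.complexConj L) 2 (borelConstantTerm ν 𝓕 Φ) x ∂(weightedTruncMeasure (↥(maximalRealSubfield L)) L (IsCMField.complexConj L) 2 k a μZ) =
          ∫ x, zFun (↥(maximalRealSubfield L)) L (IsCMField.complexConj L) 2 Φ x ∂(weightedTruncMeasure (↥(maximalRealSubfield L)) L (IsCMField.complexConj L) 2 k a μZ))
    {χ : HeckeCharacter L} {φ : (quasiSplit (↥(maximalRealSubfield L)) L (IsCMField.complexConj L) 2).Adelic → ℂ} (hφ : IsChiSection χ φ) (hφc : Continuous φ) {M : ℝ} (hφM : ∀ x, ‖φ x‖ ≤ M)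
    {z : ℂ} (hz : 1 < z.re)
    (hct : ∀ g : (quasiSplit (↥(maximalRealSubfield L)) L (IsCMField.complexConj L) 2).Adelic,
      borelConstantTerm ν 𝓕 (eisensteinSeriesU (flatSectionU φ z)) g = flatSectionU φ z g + (((ν 𝓕).toReal⁻¹ : ℝ) : ℂ) *
        ∫ v : ↥(adelicUnipotent (↥(maximalRealSubfield L)) L (IsCMField.complexConj L) 2), flatSectionU φ z ((quasiSplit (↥(maximalRealSubfield L)) L (IsCMField.complexConj L) 2).toAdelic
          (weylLongU ((IsCMField.complexConj L : L ≃ₐ[↥(maximalRealSubfield L)] L) : L →+* L) (rfl : (StdForm.antidiagonal 2).over L = (StdForm.antidiagonal 2).over L)) *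
          ((v : (quasiSplit (↥(maximalRealSubfield L)) L (IsCMField.complexConj L) 2).Adelic) * g)) ∂ν)
    (hE : MemLp ((quasiSplit (↥(maximalRealSubfield L)) L (IsCMField.complexConj L) 2).quotFun (eisensteinSeriesU (flatSectionU φ z))) 2 (μ.withDensity fun x => (((supHeight (↥(maximalRealSubfield L)) L (IsCMField.complexConj L) 2 x)⁻¹ ^ (2 * k) : ℝ≥0) : ℝ≥0∞)))
    (hα₁ : MemLp (zFun (↥(maximalRealSubfield L)) L (IsCMField.complexConj L) 2 (flatSectionU φ z)) 2 (weightedTruncMeasure (↥(maximalRealSubfield L)) L (IsCMField.complexConj L) 2 k a μZ))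
    (hα₂ : MemLp (zFun (↥(maximalRealSubfield L)) L (IsCMField.complexConj L) 2 (flatSectionU (fun g : (quasiSplit (↥(maximalRealSubfield L)) L (IsCMField.complexConj L) 2).Adelic =>
      (∫ v : ↥(adelicUnipotent (↥(maximalRealSubfield L)) L (IsCMField.complexConj L) 2), flatSectionU φ z ((quasiSplit (↥(maximalRealSubfield L)) L (IsCMField.complexConj L) 2).toAdelic
          (weylLongU ((IsCMField.complexConj L : L ≃ₐ[↥(maximalRealSubfield L)] L) : L →+* L) (rfl : (StdForm.antidiagonal 2).over L = (StdForm.antidiagonal 2).over L)) *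
          ((v : (quasiSplit (↥(maximalRealSubfield L)) L (IsCMField.complexConj L) 2).Adelic) * g)) ∂ν) * (((borelHeight g : ℝ) : ℂ) ^ (z - 1))) (1 - z)))
      2 (weightedTruncMeasure (↥(maximalRealSubfield L)) L (IsCMField.complexConj L) 2 k a μZ)) :
    cnstN (↥(maximalRealSubfield L)) L (IsCMField.complexConj L) 2 k a μZ (iota hb (toHX (↥(maximalRealSubfield L)) L (IsCMField.complexConj L) 2 k μ (eisensteinSeriesU (flatSectionU φ z)) hE)) =
      toHN (↥(maximalRealSubfield L)) L (IsCMField.complexConj L) 2 k a μZ (flatSectionU φ z) hα₁ +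
        (((ν 𝓕).toReal⁻¹ : ℝ) : ℂ) • toHN (↥(maximalRealSubfield L)) L (IsCMField.complexConj L) 2 k a μZ _ hα₂ := by
  -- the constant term as a function: `f_z + c • flatSectionU φ̃ (1 - z)`
  have hct' : borelConstantTerm ν 𝓕 (eisensteinSeriesU (flatSectionU φ z)) = flatSectionU φ z + (((ν 𝓕).toReal⁻¹ : ℝ) : ℂ) •
      flatSectionU (fun g : (quasiSplit (↥(maximalRealSubfield L)) L (IsCMField.complexConj L) 2).Adelic =>
        (∫ v : ↥(adelicUnipotent (↥(maximalRealSubfield L)) L (IsCMField.complexConj L) 2), flatSectionU φ z ((quasiSplit (↥(maximalRealSubfield L)) L (IsCMField.complexConj L) 2).toAdelic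
            (weylLongU ((IsCMField.complexConj L : L ≃ₐ[↥(maximalRealSubfield L)] L) : L →+* L) (rfl : (StdForm.antidiagonal 2).over L = (StdForm.antidiagonal 2).over L)) *
            ((v : (quasiSplit (↥(maximalRealSubfield L)) L (IsCMField.complexConj L) 2).Adelic) * g)) ∂ν) * (((borelHeight g : ℝ) : ℂ) ^ (z - 1))) (1 - z) := by
    funext g
    rw [hct g, Pi.add_apply, Pi.smul_apply, smul_eq_mul, flatSectionU_intertwinedCoeff_two ν φ z g]
  -- invariances and measurability of `E(f_z)`
  have hφG := eisensteinSeriesU_flatSectionU_quotientSubgroup_mul_of_isChiSection L hφ z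
  have hφB : ∀ γ ∈ ratBorelSubgroup (↥(maximalRealSubfield L)) L (IsCMField.complexConj L) 2, ∀ g : (quasiSplit (↥(maximalRealSubfield L)) L (IsCMField.complexConj L) 2).Adelic,
      (eisensteinSeriesU (flatSectionU φ z)) (γ * g) = (eisensteinSeriesU (flatSectionU φ z)) g := fun γ hγ g =>
    hφG γ ((quasiSplit (↥(maximalRealSubfield L)) L (IsCMField.complexConj L) 2).arithmeticSubgroup_le_quotientSubgroup (ratBorelSubgroup_le_arithmeticSubgroup (↥(maximalRealSubfield L)) L (IsCMField.complexConj L) 2 hγ)) g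
  have hφm : Measurable (eisensteinSeriesU (flatSectionU φ z)) := (continuous_eisensteinSeriesU_flatSectionU_cm_two L hz hφc hφM).measurable
  -- the `Z`-lifts of `E(f_z)` and of its constant term are in `L²(wtm)`
  have hφZ : MemLp (zFun (↥(maximalRealSubfield L)) L (IsCMField.complexConj L) 2 (eisensteinSeriesU (flatSectionU φ z))) 2 (weightedTruncMeasure (↥(maximalRealSubfield L)) L (IsCMField.complexConj L) 2 k a μZ) :=
    memLp_zFun_of_iotaBound hb hφG hE
  have hψ2 : MemLp (zFun (↥(maximalRealSubfield L)) L (IsCMField.complexConj L) 2 (borelConstantTerm ν 𝓕 (eisensteinSeriesU (flatSectionU φ z)))) 2 (weightedTruncMeasure (↥(maximalRealSubfield L)) L (IsCMField.complexConj L) 2 k a μZ) := by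
    rw [hct', zFun_add, zFun_smul]
    exact hα₁.add (hα₂.const_smul _)
  -- ℓ8 compatibility, §1's Borel P2b′, then linearity of `toHN` read a.e.
  rw [iota_toHX_eq_toHN hb hφG hE hφZ, cnstN_toHN_eq_toHN_borelConstantTerm_of_measurable ν 𝓕 k a μZ h𝓕N hdis' hφm hφB hφZ hψ2]
  refine Lp.ext ((coeFn_toHN (↥(maximalRealSubfield L)) L (IsCMField.complexConj L) 2 k a μZ _ hψ2).trans ?_)
  refine EventuallyEq.trans ?_ ((Lp.coeFn_add _ _).trans ((coeFn_toHN (↥(maximalRealSubfield L)) L (IsCMField.complexConj L) 2 k a μZ _ hα₁).add (Lp.coeFn_smul _ _))).symm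
  filter_upwards [coeFn_toHN (↥(maximalRealSubfield L)) L (IsCMField.complexConj L) 2 k a μZ _ hα₂] with x h₂
  rw [Pi.add_apply, Pi.smul_apply, h₂, hct', zFun_add, zFun_smul]
  rfl

end ConstantTerm

/-! ## §3 (S3)χ `Q [Ẽ(f_z)] = 0`: the finiteness letter `hX` for a bounded section, the inner products, the projection -/

section CuspOrthogonal

variable (L : Type) [Field L] [NumberField L] [IsCMField L]
variable [MeasurableSpace (quasiSplit (↥(maximalRealSubfield L)) L (IsCMField.complexConj L) 2).Adelic] [BorelSpace (quasiSplit (↥(maximalRealSubfield L)) L (IsCMField.complexConj L) 2).Adelic]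

omit [MeasurableSpace (quasiSplit (↥(maximalRealSubfield L)) L (IsCMField.complexConj L) 2).Adelic] [BorelSpace (quasiSplit (↥(maximalRealSubfield L)) L (IsCMField.complexConj L) 2).Adelic] in
/-- **`Σ'_q ‖f_z(q·g)‖ₑ ≤ ofReal ‖φ‖_∞ · Σ'_q ‖H^z(q·g)‖ₑ`** for a bounded `φ` (termwise `‖φ H^z‖ ≤ M·‖1·H^z‖`, `ENNReal.tsum_le_tsum`, `ENNReal.tsum_mul_left`). [cite: MoeglinWaldspurger1995, II.1.5] -/
theorem tsum_enorm_flatSectionU_le_mul_tsum {ι : Type*} (q₀ : ι → (quasiSplit (↥(maximalRealSubfield L)) L (IsCMField.complexConj L) 2).Adelic)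
    {φ : (quasiSplit (↥(maximalRealSubfield L)) L (IsCMField.complexConj L) 2).Adelic → ℂ} {M : ℝ} (hφM : ∀ x, ‖φ x‖ ≤ M) (z : ℂ) (g : (quasiSplit (↥(maximalRealSubfield L)) L (IsCMField.complexConj L) 2).Adelic) :
    (∑' q, ‖flatSectionU φ z (q₀ q * g)‖ₑ) ≤ ENNReal.ofReal M * ∑' q, ‖flatSectionU (fun _ : (quasiSplit (↥(maximalRealSubfield L)) L (IsCMField.complexConj L) 2).Adelic => (1 : ℂ)) z (q₀ q * g)‖ₑ := by
  rw [← ENNReal.tsum_mul_left]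
  refine ENNReal.tsum_le_tsum fun q => ?_
  rw [← ofReal_norm, ← ofReal_norm, ← ENNReal.ofReal_mul ((norm_nonneg _).trans (hφM 1)), norm_flatSectionU, norm_flatSectionU, norm_one, one_mul]
  exact ENNReal.ofReal_le_ofReal (mul_le_mul_of_nonneg_right (hφM _) (Real.rpow_nonneg (NNReal.coe_nonneg _) _))

/-- **THE FINITENESS LETTER `hX` (ℓ10) FOR A BOUNDED SECTION**, `1 < Re z ≤ k`: `∫⁻_𝔛 (Σ_q ‖f_z(q x̃⁻¹)‖ₑ)·‖ψ̃ x‖ₑ dμ < ∞` for `ψ̃, w₁^{2k}ψ̃ ∈ L²(μ)` — the previous lemma and the ★ spherical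
discharge `lintegral_tsum_enorm_flatSectionU_mul_enorm_lt_top_cm_two` at `φ₀ = 1`. [cite: BernsteinLapid2019, §4 Claim 2 p. 9, §7] -/
theorem lintegral_tsum_enorm_flatSectionU_mul_enorm_lt_top_chi_cm_two {δ : L} (hcδ : IsCMField.complexConj L δ = -δ) (hδ : δ ≠ 0)
    (ν : Measure ↥(adelicUnipotent (↥(maximalRealSubfield L)) L (IsCMField.complexConj L) 2)) [ν.IsHaarMeasure]
    {𝓕 : Set ↥(adelicUnipotent (↥(maximalRealSubfield L)) L (IsCMField.complexConj L) 2)}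
    (h𝓕N : IsFundamentalDomain ↥(rationalUnipotent (↥(maximalRealSubfield L)) L (IsCMField.complexConj L) 2) 𝓕 ν) (h𝓕c : IsCompact (closure 𝓕))
    (μ : Measure (quasiSplit (↥(maximalRealSubfield L)) L (IsCMField.complexConj L) 2).automorphicQuotient) [IsFiniteMeasure μ]
    {φ : (quasiSplit (↥(maximalRealSubfield L)) L (IsCMField.complexConj L) 2).Adelic → ℂ} {M : ℝ} (hφM : ∀ x, ‖φ x‖ ≤ M) {z : ℂ} (hz : 1 < z.re) {k : ℕ} (hzk : z.re ≤ k)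
    {ψ : (quasiSplit (↥(maximalRealSubfield L)) L (IsCMField.complexConj L) 2).Adelic → ℂ} (hψ2 : MemLp ((quasiSplit (↥(maximalRealSubfield L)) L (IsCMField.complexConj L) 2).quotFun ψ) 2 μ)
    (hψw : MemLp (fun x => ((supHeight (↥(maximalRealSubfield L)) L (IsCMField.complexConj L) 2 x : ℝ) ^ (2 * k) : ℂ) * (quasiSplit (↥(maximalRealSubfield L)) L (IsCMField.complexConj L) 2).quotFun ψ x) 2 μ) :
    ∫⁻ x, (∑' q : Quotient (QuotientGroup.rightRel (arithmeticBorel (↥(maximalRealSubfield L)) L (IsCMField.complexConj L) 2)),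
        ‖(flatSectionU φ z) (((q.out : (quasiSplit (↥(maximalRealSubfield L)) L (IsCMField.complexConj L) 2).arithmeticSubgroup) : (quasiSplit (↥(maximalRealSubfield L)) L (IsCMField.complexConj L) 2).Adelic) *
          (Quotient.out x : (quasiSplit (↥(maximalRealSubfield L)) L (IsCMField.complexConj L) 2).Adelic)⁻¹)‖ₑ) *
        ‖(quasiSplit (↥(maximalRealSubfield L)) L (IsCMField.complexConj L) 2).quotFun ψ x‖ₑ ∂μ < ∞ := by
  have h1 := lintegral_tsum_enorm_flatSectionU_mul_enorm_lt_top_cm_two L hcδ hδ ν h𝓕N h𝓕c μ (1 : ℂ) hz hzk hψ2 hψw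
  have hpt := fun x : (quasiSplit (↥(maximalRealSubfield L)) L (IsCMField.complexConj L) 2).automorphicQuotient =>
    tsum_enorm_flatSectionU_le_mul_tsum L
      (fun q : Quotient (QuotientGroup.rightRel (arithmeticBorel (↥(maximalRealSubfield L)) L (IsCMField.complexConj L) 2)) =>
        (((q.out : (quasiSplit (↥(maximalRealSubfield L)) L (IsCMField.complexConj L) 2).arithmeticSubgroup) : (quasiSplit (↥(maximalRealSubfield L)) L (IsCMField.complexConj L) 2).Adelic)))
      hφM z ((Quotient.out x : (quasiSplit (↥(maximalRealSubfield L)) L (IsCMField.complexConj L) 2).Adelic)⁻¹)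
  refine lt_of_le_of_lt (lintegral_mono fun x => mul_le_mul' (hpt x) le_rfl) ?_
  simp_rw [mul_assoc]
  rw [lintegral_const_mul' _ _ ENNReal.ofReal_ne_top]
  exact ENNReal.mul_lt_top ENNReal.ofReal_lt_top h1

/-- **⟪[w₁^{2k}ψ̃], [Ẽ(f_z)]⟫_{𝓗_k(𝔛)} = 0 FOR `ψ ∈ 𝒞_k` BOREL** (`1 < Re z ≤ k`, `φ` a bounded Borel `χ`-section): ★ «E ⊥ 𝒞_k» (generic in the section; `f_z` is Borel, left-`N(𝔸)`-invariant by ★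
`IsChiSection.unipotent_mul`, left-`B(F)`-invariant by ★ `IsChiSection.toAdelic_mul`) with its letter `hX` discharged above; the weighted inner product unfolds exactly as in the spherical file.
[cite: BernsteinLapid2019, §4 Claim 2 p. 9] [cite: MoeglinWaldspurger1995, II.1.7] -/
theorem inner_toHX_eisensteinSeriesU_eq_zero_chi_cm_two {δ : L} (hcδ : IsCMField.complexConj L δ = -δ) (hδ : δ ≠ 0)
    (μ : Measure (quasiSplit (↥(maximalRealSubfield L)) L (IsCMField.complexConj L) 2).automorphicQuotient) [(quasiSplit (↥(maximalRealSubfield L)) L (IsCMField.complexConj L) 2).IsAutomorphicMeasure μ]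
    (νG : Measure (quasiSplit (↥(maximalRealSubfield L)) L (IsCMField.complexConj L) 2).Adelic) [νG.IsHaarMeasure] [νG.IsInvInvariant]
    (ν : Measure ↥(adelicUnipotent (↥(maximalRealSubfield L)) L (IsCMField.complexConj L) 2)) [ν.IsHaarMeasure] [ν.IsInvInvariant]
    {𝓕 : Set ↥(adelicUnipotent (↥(maximalRealSubfield L)) L (IsCMField.complexConj L) 2)}
    (h𝓕N : IsFundamentalDomain ↥(rationalUnipotent (↥(maximalRealSubfield L)) L (IsCMField.complexConj L) 2) 𝓕 ν) (h𝓕c : IsCompact (closure 𝓕))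
    {χ : HeckeCharacter L} {φ : (quasiSplit (↥(maximalRealSubfield L)) L (IsCMField.complexConj L) 2).Adelic → ℂ} (hφ : IsChiSection χ φ) (hφm : Measurable φ) {M : ℝ} (hφM : ∀ x, ‖φ x‖ ≤ M)
    {z : ℂ} (hz : 1 < z.re) {k : ℕ} (hzk : z.re ≤ k)
    (hE : MemLp ((quasiSplit (↥(maximalRealSubfield L)) L (IsCMField.complexConj L) 2).quotFun (eisensteinSeriesU (flatSectionU φ z))) 2 (μ.withDensity fun x => (((supHeight (↥(maximalRealSubfield L)) L (IsCMField.complexConj L) 2 x)⁻¹ ^ (2 * k) : ℝ≥0) : ℝ≥0∞)))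
    {ψ : (quasiSplit (↥(maximalRealSubfield L)) L (IsCMField.complexConj L) 2).Adelic → ℂ} (hψ : ψ ∈ cuspTestClass (↥(maximalRealSubfield L)) L (IsCMField.complexConj L) 2 k ν 𝓕 μ) (hψm : Measurable ψ)
    (s : HX (↥(maximalRealSubfield L)) L (IsCMField.complexConj L) 2 k μ) (hs : (s : (quasiSplit (↥(maximalRealSubfield L)) L (IsCMField.complexConj L) 2).automorphicQuotient → ℂ) =ᵐ[μ.withDensity fun x => (((supHeight (↥(maximalRealSubfield L)) L (IsCMField.complexConj L) 2 x)⁻¹ ^ (2 * k) : ℝ≥0) : ℝ≥0∞)]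
      fun x => ((supHeight (↥(maximalRealSubfield L)) L (IsCMField.complexConj L) 2 x : ℝ) ^ (2 * k) : ℂ) * (quasiSplit (↥(maximalRealSubfield L)) L (IsCMField.complexConj L) 2).quotFun ψ x) :
    inner ℂ s (toHX (↥(maximalRealSubfield L)) L (IsCMField.complexConj L) 2 k μ (eisensteinSeriesU (flatSectionU φ z)) hE) = 0 := by
  haveI := t2Space_adeleRing_of_numberField L
  haveI := locallyCompactSpace_adeleRing' L
  haveI : T2Space (quasiSplit (↥(maximalRealSubfield L)) L (IsCMField.complexConj L) 2).Adelic := inferInstanceAs (T2Space (adelic (↥(maximalRealSubfield L)) L (IsCMField.complexConj L) 2 ((StdForm.antidiagonal 2).over L)))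
  have h𝓕₀ : ν 𝓕 ≠ 0 := measure_ne_zero_of_isFundamentalDomain_rationalUnipotent ν h𝓕N
  have h𝓕top : ν 𝓕 ≠ ∞ := ((measure_mono subset_closure).trans_lt h𝓕c.measure_lt_top).ne
  obtain ⟨c₀, hc₀, hwc⟩ := exists_pos_forall_le_supHeight_cm L
  -- the letters of ★ «E ⊥ 𝒞_k» for `f = f_z`
  have hfm : Measurable (flatSectionU φ z) := measurable_flatSectionU hφm z
  have hfN : ∀ (u : ↥(adelicUnipotent (↥(maximalRealSubfield L)) L (IsCMField.complexConj L) 2)) (g : (quasiSplit (↥(maximalRealSubfield L)) L (IsCMField.complexConj L) 2).Adelic),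
      (flatSectionU φ z) ((u : (quasiSplit (↥(maximalRealSubfield L)) L (IsCMField.complexConj L) 2).Adelic) * g) = (flatSectionU φ z) g := fun u g => by
    simp only [flatSectionU_apply, hφ.unipotent_mul u g, borelHeight_unipotent_mul u.2]
  have hfB : ∀ b ∈ arithmeticBorel (↥(maximalRealSubfield L)) L (IsCMField.complexConj L) 2, ∀ x : (quasiSplit (↥(maximalRealSubfield L)) L (IsCMField.complexConj L) 2).Adelic,
      (flatSectionU φ z) ((b : (quasiSplit (↥(maximalRealSubfield L)) L (IsCMField.complexConj L) 2).Adelic) * x) = (flatSectionU φ z) x :=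
    forall_arithmeticBorel_iff.2 (flatSectionU_toAdelic_mul_of_isChiSection hφ z)
  have hX := lintegral_tsum_enorm_flatSectionU_mul_enorm_lt_top_chi_cm_two L hcδ hδ ν h𝓕N h𝓕c μ hφM hz hzk hψ.2.2.1 hψ.2.2.2
  have h0 := integral_quotFun_eisensteinSeriesU_mul_conj_eq_zero_of_mem_cuspTestClass_cm_two L μ νG ν h𝓕N h𝓕₀ h𝓕top hfm hfN hfB hψ hψm hX
  -- the weighted inner product, unfolded to `μ`
  have hEco : ((toHX (↥(maximalRealSubfield L)) L (IsCMField.complexConj L) 2 k μ (eisensteinSeriesU (flatSectionU φ z)) hE : HX (↥(maximalRealSubfield L)) L (IsCMField.complexConj L) 2 k μ) : (quasiSplit (↥(maximalRealSubfield L)) L (IsCMField.complexConj L) 2).automorphicQuotient → ℂ)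
      =ᵐ[μ.withDensity fun x => (((supHeight (↥(maximalRealSubfield L)) L (IsCMField.complexConj L) 2 x)⁻¹ ^ (2 * k) : ℝ≥0) : ℝ≥0∞)] (quasiSplit (↥(maximalRealSubfield L)) L (IsCMField.complexConj L) 2).quotFun (eisensteinSeriesU (flatSectionU φ z)) := by
    unfold toHX; exact hE.coeFn_toLp
  have hdm : Measurable fun x : (quasiSplit (↥(maximalRealSubfield L)) L (IsCMField.complexConj L) 2).automorphicQuotient => (supHeight (↥(maximalRealSubfield L)) L (IsCMField.complexConj L) 2 x)⁻¹ ^ (2 * k) := (measurable_supHeight.inv).pow_const _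
  rw [L2.inner_def, integral_congr_ae (hs.mp (hEco.mono fun x h1 h2 => by rw [h1, h2])), integral_withDensity_eq_integral_smul hdm]
  rw [← h0]
  refine integral_congr_ae (Eventually.of_forall fun x => ?_)
  have hw0 : ((supHeight (↥(maximalRealSubfield L)) L (IsCMField.complexConj L) 2 x : ℝ) : ℂ) ≠ 0 := by
    have : (0 : ℝ) < (supHeight (↥(maximalRealSubfield L)) L (IsCMField.complexConj L) 2 x : ℝ) := lt_of_lt_of_le (by exact_mod_cast hc₀) (by exact_mod_cast hwc x)
    exact_mod_cast this.ne'
  dsimp only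
  rw [RCLike.inner_apply, NNReal.smul_def, Complex.real_smul, map_mul, map_pow, Complex.conj_ofReal]
  push_cast
  have h1 : ((supHeight (↥(maximalRealSubfield L)) L (IsCMField.complexConj L) 2 x : ℝ) : ℂ)⁻¹ ^ (2 * k) * ((supHeight (↥(maximalRealSubfield L)) L (IsCMField.complexConj L) 2 x : ℝ) : ℂ) ^ (2 * k) = 1 := by
    rw [← mul_pow, inv_mul_cancel₀ hw0, one_pow]
  linear_combination (((quasiSplit (↥(maximalRealSubfield L)) L (IsCMField.complexConj L) 2).quotFun (eisensteinSeriesU (flatSectionU φ z)) x) *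
    (starRingEnd ℂ) ((quasiSplit (↥(maximalRealSubfield L)) L (IsCMField.complexConj L) 2).quotFun ψ x)) * h1

/-- **(S3)χ `Q [Ẽ(f_z)] = 0`.**  On `U(1,1)_{L∕L⁺}`, for a bounded Borel `χ`-section `φ`, `1 < Re z ≤ k`, and ANY set `𝒮 ⊆ 𝓗_k(𝔛)` of classes a.e. equal to `w₁^{2k}·ψ̃` with `ψ ∈ 𝒞_k` Borel, the
orthogonal projection onto the closed span of `𝒮` kills `[Ẽ(f_z)]` (★ spherical §3 `starProjection_topologicalClosure_span_eq_zero`). [cite: BernsteinLapid2019, §4 Claim 2 p. 9, §7] -/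
theorem starProjection_toHX_eisensteinSeriesU_eq_zero_chi_cm_two {δ : L} (hcδ : IsCMField.complexConj L δ = -δ) (hδ : δ ≠ 0)
    (μ : Measure (quasiSplit (↥(maximalRealSubfield L)) L (IsCMField.complexConj L) 2).automorphicQuotient) [(quasiSplit (↥(maximalRealSubfield L)) L (IsCMField.complexConj L) 2).IsAutomorphicMeasure μ]
    (νG : Measure (quasiSplit (↥(maximalRealSubfield L)) L (IsCMField.complexConj L) 2).Adelic) [νG.IsHaarMeasure] [νG.IsInvInvariant]
    (ν : Measure ↥(adelicUnipotent (↥(maximalRealSubfield L)) L (IsCMField.complexConj L) 2)) [ν.IsHaarMeasure] [ν.IsInvInvariant]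
    {𝓕 : Set ↥(adelicUnipotent (↥(maximalRealSubfield L)) L (IsCMField.complexConj L) 2)}
    (h𝓕N : IsFundamentalDomain ↥(rationalUnipotent (↥(maximalRealSubfield L)) L (IsCMField.complexConj L) 2) 𝓕 ν) (h𝓕c : IsCompact (closure 𝓕))
    {χ : HeckeCharacter L} {φ : (quasiSplit (↥(maximalRealSubfield L)) L (IsCMField.complexConj L) 2).Adelic → ℂ} (hφ : IsChiSection χ φ) (hφm : Measurable φ) {M : ℝ} (hφM : ∀ x, ‖φ x‖ ≤ M)
    {z : ℂ} (hz : 1 < z.re) {k : ℕ} (hzk : z.re ≤ k)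
    (hE : MemLp ((quasiSplit (↥(maximalRealSubfield L)) L (IsCMField.complexConj L) 2).quotFun (eisensteinSeriesU (flatSectionU φ z))) 2 (μ.withDensity fun x => (((supHeight (↥(maximalRealSubfield L)) L (IsCMField.complexConj L) 2 x)⁻¹ ^ (2 * k) : ℝ≥0) : ℝ≥0∞)))
    {𝒮 : Set (HX (↥(maximalRealSubfield L)) L (IsCMField.complexConj L) 2 k μ)}
    (h𝒮 : ∀ s ∈ 𝒮, ∃ ψ ∈ cuspTestClass (↥(maximalRealSubfield L)) L (IsCMField.complexConj L) 2 k ν 𝓕 μ, Measurable ψ ∧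
      (s : (quasiSplit (↥(maximalRealSubfield L)) L (IsCMField.complexConj L) 2).automorphicQuotient → ℂ) =ᵐ[μ.withDensity fun x => (((supHeight (↥(maximalRealSubfield L)) L (IsCMField.complexConj L) 2 x)⁻¹ ^ (2 * k) : ℝ≥0) : ℝ≥0∞)]
        fun x => ((supHeight (↥(maximalRealSubfield L)) L (IsCMField.complexConj L) 2 x : ℝ) ^ (2 * k) : ℂ) * (quasiSplit (↥(maximalRealSubfield L)) L (IsCMField.complexConj L) 2).quotFun ψ x) :
    (Submodule.span ℂ 𝒮).topologicalClosure.starProjection (toHX (↥(maximalRealSubfield L)) L (IsCMField.complexConj L) 2 k μ (eisensteinSeriesU (flatSectionU φ z)) hE) = 0 := by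
  refine starProjection_topologicalClosure_span_eq_zero fun s hs => ?_
  obtain ⟨ψ, hψ, hψm, hsψ⟩ := h𝒮 s hs
  exact inner_toHX_eisensteinSeriesU_eq_zero_chi_cm_two L hcδ hδ μ νG ν h𝓕N h𝓕c hφ hφm hφM hz hzk hE hψ hψm s hsψ

end CuspOrthogonal

end Summit.HodgeConjecture.HodgeConjecture.Cruxes.H413.K2E1ChiEisensteinSolvesXSystemU2
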